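import Summits.Parity.BatemanHorn.Theses.VanishingDimension
import Literature.NumberTheory.Sieve.BatemanHornProofs

/-!
# Strategist sketch — crux `TiltCalibration` (stmt-Parity-18604, route-Parity-VanishingDimension, rank 3)

Typed companions of `Cruxes/TiltCalibration/STRATEGY-CENSUS.md` (crux-strategist seat
planner-cstrat-stmt-Parity-18604-b1-0, 2026-08-17).  Nothing here is an item of the route; the crux
itself is referenced BY NAME (`Summit.Parity.BatemanHorn.Theses.VanishingDimension.TiltCalibration`).

* §1 `cellPred`, `PrimeCellCalibration`, `OffCellNegligible` and the PROVED glue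
  `tiltCalibration_of_cells : OffCellNegligible → PrimeCellCalibration → TiltCalibration`
  (census §Decomposition: the best typed split; `PrimeCellCalibration` remains the whole crux).
* §2 `TiltedMassLimitGerm` (census §Strengthen, S1: fixed-`z` limits + germ; strictly stronger, it is
  the LSD law along `f` on the segment `(0, z₀)`), with the PROVED implication to the crux.
* §3 `PrimeCellLowerBound` and the PROVED `primeCellLowerBound_of :
  OffCellNegligible → TiltCalibration → PrimeCellLowerBound` (census §Negation: the typed necessary
  condition — order-of-magnitude production of values whose `x^θ`-rough parts are simultaneously
  prime powers, under the tilt); `LargePrimeFactorThreeHalves` (its unpacked form at `X² + 1`: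
  `P⁺(n²+1) ≥ x^{3/2}/4` for `≫ x (log x)^{z-1}` integers `n ≤ x`; print reaches exponent `1.3`).
* §4 `TiltCalibrationLinearOne` (census §Transfer: the solved sibling, `k = 1`, `deg = 1`, a
  `--supports`-grade target for provers: Selberg 1954 / Montgomery–Vaughan Thm 7.18 for `ω` in a
  progression + Mertens).
-/

noncomputable section

namespace Summit.Parity.BatemanHorn.Cruxes.TiltCalibration.Strategist

open scoped BigOperators Classical
open Filter Finset Summit.Parity.BatemanHorn.Theses.VanishingDimension

/-! ## §1 The prime cell and the cell decomposition -/

/-- The prime-cell predicate at level `x^θ`: every `fᵢ(n)` has EXACTLY ONE prime factor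
`p ≥ ⌊x^θ⌋₊` (counted without multiplicity), i.e. its `x^θ`-rough part is a prime power. -/
def cellPred {k : ℕ} (f : Fin k → Polynomial ℤ) (θ : ℝ) (x n : ℕ) : Prop :=
  ∀ i, ((((f i).eval (n : ℤ)).toNat.primeFactors).filter (fun p : ℕ => ⌊(x : ℝ) ^ θ⌋₊ ≤ p)).card = 1

/-- KERNEL of the cell split: the crux's calibrated double limit with the tilted mass restricted to
the prime cell. Informally: under the `z^{Σω}`-tilt, the `x^θ`-rough parts of `f₁(n),…,f_k(n)` are
simultaneously prime (powers) with the Bateman–Horn frequency. This piece carries the whole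
difficulty (census §Decomposition, §Negation). -/
def PrimeCellCalibration : Prop :=
  ∀ (k : ℕ) (f : Fin k → Polynomial ℤ), Literature.NumberTheory.Sieve.IsBatemanHornSystem f →
    ∀ θ : ℝ, 0 < θ → θ ≤ 1 / 4 → ∀ ε : ℝ, 0 < ε → ∃ z₂ : ℝ, 0 < z₂ ∧ ∀ z : ℝ, 0 < z → z < z₂ →
      let w : ℕ → ℝ := fun n => z ^ (∑ i, ArithmeticFunction.cardDistinctFactors (((f i).eval (n : ℤ)).toNat))
      let cnt : ℕ → ℕ → ℕ := fun p s => (Finset.univ.filter (fun i => (p : ℤ) ∣ (f i).eval (s : ℤ))).card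
      let m : ℕ → ℝ := fun p => ∑ s ∈ Finset.range p, z ^ cnt p s
      let V : ℕ → ℝ := fun x => ∏ p ∈ (Finset.range ⌊(x : ℝ) ^ θ⌋₊).filter Nat.Prime,
        ((p : ℝ) - Literature.NumberTheory.Sieve.polyRootCountMod f p) / m p
      ∀ᶠ x : ℕ in atTop,
        |Real.log x ^ k * (∑ n ∈ (Finset.Icc 1 x).filter (fun n : ℕ => cellPred f θ x n), w n) * V x /
            (z ^ k * (x : ℝ)) -
          Literature.NumberTheory.Sieve.batemanHornConst f / ∏ i, ((f i).natDegree : ℝ)| ≤ ε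

/-- PROVABLE piece of the cell split (sieve UPPER bounds only): after calibration, the tilted mass
OFF the prime cell — some `fᵢ(n)` `x^θ`-smooth (Rankin + Nair–Tenenbaum-class bound, relative size
`≪ z^{4·deg}`), or some rough part with `≥ 2` prime factors (extra factor `z`; upper-bound sieve /
`NairTenenbaum1998_theorem1`) — is eventually at most `ε`, for all `z < z₂(f, θ, ε)`. -/
def OffCellNegligible : Prop :=
  ∀ (k : ℕ) (f : Fin k → Polynomial ℤ), Literature.NumberTheory.Sieve.IsBatemanHornSystem f →
    ∀ θ : ℝ, 0 < θ → θ ≤ 1 / 4 → ∀ ε : ℝ, 0 < ε → ∃ z₂ : ℝ, 0 < z₂ ∧ ∀ z : ℝ, 0 < z → z < z₂ →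
      let w : ℕ → ℝ := fun n => z ^ (∑ i, ArithmeticFunction.cardDistinctFactors (((f i).eval (n : ℤ)).toNat))
      let cnt : ℕ → ℕ → ℕ := fun p s => (Finset.univ.filter (fun i => (p : ℤ) ∣ (f i).eval (s : ℤ))).card
      let m : ℕ → ℝ := fun p => ∑ s ∈ Finset.range p, z ^ cnt p s
      let V : ℕ → ℝ := fun x => ∏ p ∈ (Finset.range ⌊(x : ℝ) ^ θ⌋₊).filter Nat.Prime,
        ((p : ℝ) - Literature.NumberTheory.Sieve.polyRootCountMod f p) / m p
      ∀ᶠ x : ℕ in atTop,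
        |Real.log x ^ k * (∑ n ∈ (Finset.Icc 1 x).filter (fun n : ℕ => ¬ cellPred f θ x n), w n) * V x /
            (z ^ k * (x : ℝ))| ≤ ε

/-- The cell split, PROVED: `OffCellNegligible → PrimeCellCalibration → TiltCalibration`
(sum over `[1,x]` = prime cell + complement; `ε/2 + ε/2`). -/
theorem tiltCalibration_of_cells (hoff : OffCellNegligible) (hcell : PrimeCellCalibration) :
    TiltCalibration := by
  intro k f hf θ hθ hθ' ε hε
  obtain ⟨z₁, hz₁, h₁⟩ := hoff k f hf θ hθ hθ' (ε / 2) (by positivity)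
  obtain ⟨z₂, hz₂, h₂⟩ := hcell k f hf θ hθ hθ' (ε / 2) (by positivity)
  refine ⟨min z₁ z₂, lt_min hz₁ hz₂, fun z hz hzlt => ?_⟩
  have H₁ := h₁ z hz (lt_of_lt_of_le hzlt (min_le_left _ _))
  have H₂ := h₂ z hz (lt_of_lt_of_le hzlt (min_le_right _ _))
  simp only at H₁ H₂ ⊢
  filter_upwards [H₁, H₂] with x hx₁ hx₂
  have hsplit := Finset.sum_filter_add_sum_filter_not (Finset.Icc 1 x)
    (fun n : ℕ => cellPred f θ x n)
    (fun n : ℕ => z ^ (∑ i, ArithmeticFunction.cardDistinctFactors (((f i).eval (n : ℤ)).toNat)))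
  rw [← hsplit]
  set S₁ := ∑ n ∈ (Finset.Icc 1 x).filter (fun n : ℕ => cellPred f θ x n),
    z ^ (∑ i, ArithmeticFunction.cardDistinctFactors (((f i).eval (n : ℤ)).toNat)) with hS₁
  set S₂ := ∑ n ∈ (Finset.Icc 1 x).filter (fun n : ℕ => ¬ cellPred f θ x n),
    z ^ (∑ i, ArithmeticFunction.cardDistinctFactors (((f i).eval (n : ℤ)).toNat)) with hS₂
  set L := Real.log x ^ k with hL
  set V := ∏ p ∈ (Finset.range ⌊(x : ℝ) ^ θ⌋₊).filter Nat.Prime,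
    ((p : ℝ) - Literature.NumberTheory.Sieve.polyRootCountMod f p) /
      ∑ s ∈ Finset.range p, z ^ (Finset.univ.filter (fun i => (p : ℤ) ∣ (f i).eval (s : ℤ))).card with hV
  set D := z ^ k * (x : ℝ) with hD
  set C := Literature.NumberTheory.Sieve.batemanHornConst f / ∏ i, ((f i).natDegree : ℝ) with hC
  have key : L * (S₁ + S₂) * V / D - C = (L * S₁ * V / D - C) + L * S₂ * V / D := by ring
  rw [key]
  calc |L * S₁ * V / D - C + L * S₂ * V / D|
      ≤ |L * S₁ * V / D - C| + |L * S₂ * V / D| := abs_add_le _ _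
    _ ≤ ε / 2 + ε / 2 := add_le_add hx₂ hx₁
    _ = ε := by ring

/-! ## §2 Strengthen: fixed-`z` limits plus the germ (the birth split, as ONE statement) -/

/-- `S⁺₁`: for every small `z` the calibrated tilted mass CONVERGES (`x → ∞`) to some `c(z)`, and
`c(z) → C(f)/∏ deg fᵢ` as `z → 0⁺`. Strictly stronger than the crux: its first conjunct is the
Landau–Selberg–Delange law along `f` at every real `z ∈ (0, z₀)` (the `y → 0⁺` end of the segment
problem `SelbergDelangeRigidity.LSDRealSegment`, whose chain recorded no strategy short of a
beyond-level law: `Cruxes/LSDRealSegment/STRATEGY-CENSUS.md`). -/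
def TiltedMassLimitGerm : Prop :=
  ∀ (k : ℕ) (f : Fin k → Polynomial ℤ), Literature.NumberTheory.Sieve.IsBatemanHornSystem f →
    ∀ θ : ℝ, 0 < θ → θ ≤ 1 / 4 → ∃ z₀ : ℝ, 0 < z₀ ∧ ∃ c : ℝ → ℝ,
      (∀ z : ℝ, 0 < z → z < z₀ →
        let w : ℕ → ℝ := fun n => z ^ (∑ i, ArithmeticFunction.cardDistinctFactors (((f i).eval (n : ℤ)).toNat))
        let cnt : ℕ → ℕ → ℕ := fun p s => (Finset.univ.filter (fun i => (p : ℤ) ∣ (f i).eval (s : ℤ))).card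
        let m : ℕ → ℝ := fun p => ∑ s ∈ Finset.range p, z ^ cnt p s
        let V : ℕ → ℝ := fun x => ∏ p ∈ (Finset.range ⌊(x : ℝ) ^ θ⌋₊).filter Nat.Prime,
          ((p : ℝ) - Literature.NumberTheory.Sieve.polyRootCountMod f p) / m p
        Tendsto (fun x : ℕ => Real.log x ^ k * (∑ n ∈ Finset.Icc 1 x, w n) * V x / (z ^ k * (x : ℝ)))
          atTop (nhds (c z))) ∧
      Tendsto c (nhdsWithin 0 (Set.Ioi 0))
        (nhds (Literature.NumberTheory.Sieve.batemanHornConst f / ∏ i, ((f i).natDegree : ℝ)))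

/-- `S⁺₁ → crux` (PROVED; this is the birth skeleton `TiltedMassLimit + TiltGerm` in one piece). -/
theorem tiltCalibration_of_limitGerm (h : TiltedMassLimitGerm) : TiltCalibration := by
  intro k f hf θ hθ hθ' ε hε
  obtain ⟨z₀, hz₀, c, hlim, hgerm⟩ := h k f hf θ hθ hθ'
  set C := Literature.NumberTheory.Sieve.batemanHornConst f / ∏ i, ((f i).natDegree : ℝ) with hC
  -- germ: eventually (z → 0⁺) |c z - C| < ε/2
  have hg : ∀ᶠ z in nhdsWithin 0 (Set.Ioi 0), |c z - C| < ε / 2 := by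
    have := (Metric.tendsto_nhds.mp hgerm) (ε / 2) (by positivity)
    filter_upwards [this] with z hz
    rwa [Real.dist_eq] at hz
  -- extract a threshold z₂ ≤ z₀
  obtain ⟨δ, hδ, hδ'⟩ : ∃ δ > 0, ∀ z : ℝ, 0 < z → z < δ → |c z - C| < ε / 2 := by
    rw [Filter.Eventually, mem_nhdsGT_iff_exists_Ioo_subset] at hg
    obtain ⟨u, hu, hsub⟩ := hg
    exact ⟨u, hu, fun z hz hzu => hsub ⟨hz, hzu⟩⟩
  refine ⟨min z₀ δ, lt_min hz₀ hδ, fun z hz hzlt => ?_⟩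
  have hz0 : z < z₀ := lt_of_lt_of_le hzlt (min_le_left _ _)
  have hzδ : z < δ := lt_of_lt_of_le hzlt (min_le_right _ _)
  have HL := hlim z hz hz0
  simp only at HL ⊢
  have hev : ∀ᶠ x : ℕ in atTop,
      |Real.log x ^ k * (∑ n ∈ Finset.Icc 1 x,
          z ^ (∑ i, ArithmeticFunction.cardDistinctFactors (((f i).eval (n : ℤ)).toNat))) *
        (∏ p ∈ (Finset.range ⌊(x : ℝ) ^ θ⌋₊).filter Nat.Prime,
          ((p : ℝ) - Literature.NumberTheory.Sieve.polyRootCountMod f p) /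
            ∑ s ∈ Finset.range p, z ^ (Finset.univ.filter (fun i => (p : ℤ) ∣ (f i).eval (s : ℤ))).card) /
        (z ^ k * (x : ℝ)) - c z| < ε / 2 := by
    have := (Metric.tendsto_nhds.mp HL) (ε / 2) (by positivity)
    filter_upwards [this] with x hx
    rwa [Real.dist_eq] at hx
  filter_upwards [hev] with x hx
  have hcz := hδ' z hz hzδ
  calc _ = |(Real.log x ^ k * (∑ n ∈ Finset.Icc 1 x,
          z ^ (∑ i, ArithmeticFunction.cardDistinctFactors (((f i).eval (n : ℤ)).toNat))) *
        (∏ p ∈ (Finset.range ⌊(x : ℝ) ^ θ⌋₊).filter Nat.Prime,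
          ((p : ℝ) - Literature.NumberTheory.Sieve.polyRootCountMod f p) /
            ∑ s ∈ Finset.range p, z ^ (Finset.univ.filter (fun i => (p : ℤ) ∣ (f i).eval (s : ℤ))).card) /
        (z ^ k * (x : ℝ)) - c z) + (c z - C)| := by ring_nf
    _ ≤ _ := abs_add_le _ _
    _ ≤ ε / 2 + ε / 2 := add_le_add hx.le hcz.le
    _ = ε := by ring

/-! ## §3 Negation lens: the typed necessary condition -/

/-- NECESSARY CONDITION (negation lens): for small `z`, the calibrated tilted mass of the PRIME CELL
is eventually at least `C(f)/(2 ∏ deg fᵢ) > 0`; unpacked (`V ≍ (θ log x)^{-kz}`): the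
`z^{Σ ω(smooth parts)}`-weighted number of `n ≤ x` all of whose `fᵢ(n)` have `x^θ`-rough part a
prime power is `≫ x (log x)^{k(z-1)}`. For one polynomial of degree `d ≥ 2` this asks to PRODUCE, in
order of magnitude, values `f(n) = (x^θ-smooth) · p^v` weighted against many small prime factors —
not in print for any member (census §Negation). -/
def PrimeCellLowerBound : Prop :=
  ∀ (k : ℕ) (f : Fin k → Polynomial ℤ), Literature.NumberTheory.Sieve.IsBatemanHornSystem f →
    ∀ θ : ℝ, 0 < θ → θ ≤ 1 / 4 → ∃ z₂ : ℝ, 0 < z₂ ∧ ∀ z : ℝ, 0 < z → z < z₂ →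
      let w : ℕ → ℝ := fun n => z ^ (∑ i, ArithmeticFunction.cardDistinctFactors (((f i).eval (n : ℤ)).toNat))
      let cnt : ℕ → ℕ → ℕ := fun p s => (Finset.univ.filter (fun i => (p : ℤ) ∣ (f i).eval (s : ℤ))).card
      let m : ℕ → ℝ := fun p => ∑ s ∈ Finset.range p, z ^ cnt p s
      let V : ℕ → ℝ := fun x => ∏ p ∈ (Finset.range ⌊(x : ℝ) ^ θ⌋₊).filter Nat.Prime,
        ((p : ℝ) - Literature.NumberTheory.Sieve.polyRootCountMod f p) / m p
      ∀ᶠ x : ℕ in atTop,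
        Literature.NumberTheory.Sieve.batemanHornConst f / (2 * ∏ i, ((f i).natDegree : ℝ)) ≤
          Real.log x ^ k * (∑ n ∈ (Finset.Icc 1 x).filter (fun n : ℕ => cellPred f θ x n), w n) * V x /
            (z ^ k * (x : ℝ))

/-- PROVED: the crux together with the (provable) off-cell bound forces the prime-cell lower bound.
Uses `C(f) > 0` (`IsBatemanHornSystem.hasBatemanHornConst_holds`) and `deg fᵢ ≥ 1`. -/
theorem primeCellLowerBound_of (hoff : OffCellNegligible) (h : TiltCalibration) :
    PrimeCellLowerBound := by
  intro k f hf θ hθ hθ'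
  set C := Literature.NumberTheory.Sieve.batemanHornConst f / ∏ i, ((f i).natDegree : ℝ) with hC
  have hCpos : 0 < C := by
    have h1 : 0 < Literature.NumberTheory.Sieve.batemanHornConst f :=
      (Literature.NumberTheory.Sieve.IsBatemanHornSystem.hasBatemanHornConst_holds hf).2
    have h2 : 0 < ∏ i, ((f i).natDegree : ℝ) := by
      refine Finset.prod_pos fun i _ => ?_
      exact_mod_cast hf.natDegree_pos i
    exact div_pos h1 h2
  obtain ⟨z₁, hz₁, h₁⟩ := hoff k f hf θ hθ hθ' (C / 4) (by positivity)
  obtain ⟨z₂, hz₂, h₂⟩ := h k f hf θ hθ hθ' (C / 4) (by positivity)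
  refine ⟨min z₁ z₂, lt_min hz₁ hz₂, fun z hz hzlt => ?_⟩
  have H₁ := h₁ z hz (lt_of_lt_of_le hzlt (min_le_left _ _))
  have H₂ := h₂ z hz (lt_of_lt_of_le hzlt (min_le_right _ _))
  simp only at H₁ H₂ ⊢
  filter_upwards [H₁, H₂] with x hx₁ hx₂
  have hsplit := Finset.sum_filter_add_sum_filter_not (Finset.Icc 1 x)
    (fun n : ℕ => cellPred f θ x n)
    (fun n : ℕ => z ^ (∑ i, ArithmeticFunction.cardDistinctFactors (((f i).eval (n : ℤ)).toNat)))
  rw [← hsplit] at hx₂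
  set S₁ := ∑ n ∈ (Finset.Icc 1 x).filter (fun n : ℕ => cellPred f θ x n),
    z ^ (∑ i, ArithmeticFunction.cardDistinctFactors (((f i).eval (n : ℤ)).toNat)) with hS₁
  set S₂ := ∑ n ∈ (Finset.Icc 1 x).filter (fun n : ℕ => ¬ cellPred f θ x n),
    z ^ (∑ i, ArithmeticFunction.cardDistinctFactors (((f i).eval (n : ℤ)).toNat)) with hS₂
  set L := Real.log x ^ k with hL
  set V := ∏ p ∈ (Finset.range ⌊(x : ℝ) ^ θ⌋₊).filter Nat.Prime,
    ((p : ℝ) - Literature.NumberTheory.Sieve.polyRootCountMod f p) /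
      ∑ s ∈ Finset.range p, z ^ (Finset.univ.filter (fun i => (p : ℤ) ∣ (f i).eval (s : ℤ))).card with hV
  set D := z ^ k * (x : ℝ) with hD
  have key : L * (S₁ + S₂) * V / D = L * S₁ * V / D + L * S₂ * V / D := by ring
  rw [key] at hx₂
  have e1 := (abs_le.mp hx₂).1
  have e2 := (abs_le.mp hx₁).2
  have hC2 : Literature.NumberTheory.Sieve.batemanHornConst f / (2 * ∏ i, ((f i).natDegree : ℝ)) = C / 2 := by
    rw [hC]; ring
  rw [hC2]
  linarith

/-- The HARDNESS CERTIFICATE at the first nonlinear member `f = X² + 1` (census §Negation, prose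
chain): `PrimeCellLowerBound` + the tilted smooth-part tail (`a ≤ x^{1/2}` off a set of relative
tilted mass `O(z²)`, Rankin on the squarefree kernel + Nair–Tenenbaum class `M(1,1,ε)`) + Mertens for
`V ≍ (θ log x)^{-z}` give: for every small `z > 0`, eventually
`#{n ≤ x : some prime p ≥ x^{3/2}/4 divides n² + 1} ≥ c_z · x · (log x)^{z - 1}`.
Print: `P⁺(n²+1) > n^{1.3}` infinitely often (Pascadi, Forum Math. Pi 2026, doi:10.1017/fmp.2026.10025,
improving Merikoski's `1.279` and de la Bretèche–Drappeau's `1.2182`); exponent `3/2` (indeed `2 − η`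
for every `η`, taking `θ, η → 0`) is far beyond every Chebyshev–Hooley-type result. Typed only. -/
def LargePrimeFactorThreeHalves : Prop :=
  ∃ z₂ : ℝ, 0 < z₂ ∧ ∀ z : ℝ, 0 < z → z < z₂ → ∃ c : ℝ, 0 < c ∧
    ∀ᶠ x : ℕ in atTop,
      c * (x : ℝ) * Real.log x ^ (z - 1) ≤
        (((Finset.Icc 1 x).filter (fun n : ℕ =>
            ∃ p : ℕ, p ∈ (n ^ 2 + 1).primeFactors ∧ (x : ℝ) ^ (3 / 2 : ℝ) / 4 ≤ (p : ℝ))).card : ℝ)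

/-! ## §4 Transfer: the solved sibling as a support-grade target -/

/-- The `k = 1`, `deg f = 1` member of the crux (`f = (aX + b)`, `gcd(a,b) = 1`, `a > 0`): Selberg
1954 / Montgomery–Vaughan 2007 Thm 7.18-type law for `z^{ω}` on the progression `b mod a` plus
Mertens for `V`; the Euler products cancel and the `x`-limit is `a·(e^{-γ}/θ)^z/Γ(1+z) → a = C(f)/1`
(grounder g79-4 / refuter rattack-18604 hand computation). A `--supports` target for provers; the
in-tree engines are `MontgomeryVaughan2007_thm_7_18(_Omega)_holds`, `SatheSelberg*`,
`SelbergDelangeRigidityLSDRealSegmentTypeILevinFainleib`-style elementary renewal. -/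
def TiltCalibrationLinearOne : Prop :=
  ∀ (f : Fin 1 → Polynomial ℤ), Literature.NumberTheory.Sieve.IsBatemanHornSystem f →
    (f 0).natDegree = 1 →
    ∀ θ : ℝ, 0 < θ → θ ≤ 1 / 4 → ∀ ε : ℝ, 0 < ε → ∃ z₂ : ℝ, 0 < z₂ ∧ ∀ z : ℝ, 0 < z → z < z₂ →
      let w : ℕ → ℝ := fun n => z ^ (∑ i, ArithmeticFunction.cardDistinctFactors (((f i).eval (n : ℤ)).toNat))
      let cnt : ℕ → ℕ → ℕ := fun p s => (Finset.univ.filter (fun i => (p : ℤ) ∣ (f i).eval (s : ℤ))).card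
      let m : ℕ → ℝ := fun p => ∑ s ∈ Finset.range p, z ^ cnt p s
      let V : ℕ → ℝ := fun x => ∏ p ∈ (Finset.range ⌊(x : ℝ) ^ θ⌋₊).filter Nat.Prime,
        ((p : ℝ) - Literature.NumberTheory.Sieve.polyRootCountMod f p) / m p
      ∀ᶠ x : ℕ in atTop,
        |Real.log x ^ 1 * (∑ n ∈ Finset.Icc 1 x, w n) * V x / (z ^ 1 * (x : ℝ)) -
          Literature.NumberTheory.Sieve.batemanHornConst f / ∏ i, ((f i).natDegree : ℝ)| ≤ ε

/-- The linear member is an instance of the crux (so a proof of it is a `--supports` lemma, and a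
refutation of it would refute the crux). PROVED. -/
theorem tiltCalibrationLinearOne_of (h : TiltCalibration) : TiltCalibrationLinearOne := by
  intro f hf _hdeg θ hθ hθ' ε hε
  simpa using h 1 f hf θ hθ hθ' ε hε

end Summit.Parity.BatemanHorn.Cruxes.TiltCalibration.Strategist

end
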